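import Literature.NumberTheory.GaloisRepresentations.PstWeilDeligne
import Literature.NumberTheory.GaloisRepresentations.PAdicHodgeProofs
import Literature.NumberTheory.GaloisRepresentations.PotentialDiagonalizabilityCriteriaProofs
import Literature.NumberTheory.Automorphic.ReciprocityGLnQlModelProofs
import HarnessLib

/-!
# De Rham heredity: the diagonal blocks of a block-triangular de Rham representation are de Rham

Topic `Literature/NumberTheory/GaloisRepresentations`; a theorems-only companion of `PstWeilDeligne.lean`
(no definitions, no named facts).

Let `F` be a field, `ℓ` a prime, `alg` a `ℚ_ℓ`-algebra structure on `F` and `𝔅` a period-ring datum for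
`Γ_F = Field.absoluteGaloisGroup F` over `ℚ_ℓ` with invariant field `F` (accepted `PeriodRingData`:
Fontaine's regular `(ℚ_ℓ, Γ_F)`-rings; intended `B_dR(F)`).  Recall (accepted `FramedRep.IsDeRhamWith`,
`PstWeilDeligneData.IsDeRhamFramed`) that a framed `T : Γ_F →ₜ* GL_n(ℚ̄_ℓ)` is *de Rham* when it has a
model `rE` over a finite `E/ℚ_ℓ` (accepted `HasQlModel`) whose underlying `ℚ_ℓ`-linear representation
(accepted `restrictScalarsQl`) is `𝔅`-admissible.  The main result of this file is

* `FramedRep.IsDeRhamWith.blocks` / `PstWeilDeligneData.isDeRhamFramed_blocks`: if `T` is block upper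
  triangular along `e : Fin m ⊕ Fin q ≃ Fin n`, `T(g) = e·(A(g) B(g); 0 D(g))·e⁻¹` with framed
  `A : Γ_F →ₜ* GL_m(ℚ̄_ℓ)` (the sub-object) and `D : Γ_F →ₜ* GL_q(ℚ̄_ℓ)` (the quotient), and `T` is de
  Rham, then `A` and `D` are de Rham.

This is Fontaine's Prop. 1.5.2 of Exposé III (for a regular `(ℚ_p, Γ)`-ring `B`, sub-objects and
quotients of `B`-admissible representations are `B`-admissible), whose algebraic core is already in the
tree (`PeriodRingData.isAdmissible_of_shortExact`, from Fontaine's inequality `finrank_D_le_holds` and the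
exactness of `B ⊗_{ℚ_p} −`), together with the bookkeeping of frames and coefficient fields forced by
the definition of `IsDeRhamWith`:

* `PeriodRingData.isAdmissible_restrictScalars_baseChange_iff` — admissibility of the `ℚ_p`-restriction
  of a framed representation over `E' ⊆ ℚ̄_p` is unchanged by a finite extension `E'' ⊇ E'` of the
  coefficients (`E''ⁿ ≅ (E'ⁿ)^{[E'':E']}` as `ℚ_p[Γ]`-modules and `D_B` is additive; the one-sided form is
  the tree's `isAdmissible_restrictScalars_of_le`, stated there for crystalline data only);
* `PeriodRingData.isAdmissible_restrictScalars_conj_iff` — and by a change of frame `Q ∈ GL_n(E')`;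
* `PeriodRingData.isAdmissible_restrictScalars_blocks` — the block form over `E'` gives the exact
  sequence `0 → E'^m → E'^n → E'^q → 0` of `ℚ_p[Γ]`-modules, whence Prop. 1.5.2 applies;
* `exists_conj_baseChange_eq_of_hasQlModel`, `FramedRep.exists_blocks_of_baseChange_eq` — descent of the
  frame: from `T = P (rE ⊗ ℚ̄_ℓ) P⁻¹` one passes to the finite extension `E' = E(P, P⁻¹)`, over which
  `T`, hence its blocks `A`, `D` (and `B`), have all their entries, so that `T|E' = Q (rE ⊗_E E') Q⁻¹` is
  block triangular over `E'` with blocks the corestrictions of `A` and `D`.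

## References

* J.-M. Fontaine, *Représentations `p`-adiques semi-stables*, Astérisque 223 (1994), Exposé III,
  Prop. 1.5.2 (sub-objects, quotients, sums of `B`-admissible representations), Thm. 1.5.2.
  [FontaineAsterisque223III]
* K. Buzzard, T. Gee, *The conjectural connections between automorphic representations and Galois
  representations*, LMS Lecture Note Ser. 414 (2014), §2.2 (independence of the coefficient field).
  [BuzzardGeeLMS2014]
-/

noncomputable section

open Field
open scoped TensorProduct Matrix

namespace Literature.NumberTheory.GaloisRepresentations

/-! ### Admissibility of `ℚ_p`-restrictions of framed representations: coefficients, frames, blocks -/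

namespace PeriodRingData

section Coefficients

-- Mathlib's own global value (nested instance problems on `𝔅.B ⊗[P] M`, see `PAdicHodgeProofs`).
set_option maxSynthPendingDepth 3

universe u v' v'' w

variable {p : ℕ} [Fact p.Prime] {Γ : Type u} [Group Γ] [TopologicalSpace Γ]
  {E₁ : Type v'} [Field E₁] [Algebra ℚ_[p] E₁] (𝔅 : PeriodRingData.{u, 0, v', w} Γ ℚ_[p] E₁) {n : ℕ}

/-- **Admissibility does not depend on the (finite) coefficient field.**  For intermediate fields
`E' ≤ E''` of `ℚ̄_p / ℚ_p` with `E''/ℚ_p` finite and a framed representation `r : Γ →ₜ* GL_n(E')`, the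
`ℚ_p`-restriction of the extension of scalars `r ⊗_{E'} E''` is `B`-admissible iff the `ℚ_p`-restriction
of `r` is: as `ℚ_p[Γ]`-modules `E''ⁿ ≅ (E'ⁿ)^d`, `d = [E'' : E'] ≥ 1`, and finite sums of representations
are admissible iff all summands are (`isAdmissible_pi_iff`).
Ref: Fontaine, Astérisque 223 (1994), Exposé III, Prop. 1.5.2; Buzzard–Gee 2014, §2.2.
[cite: FontaineAsterisque223III, Prop. 1.5.2] -/
theorem isAdmissible_restrictScalars_baseChange_iff
    {E' E'' : IntermediateField ℚ_[p] (PadicAlgCl p)} (h : E' ≤ E'') [FiniteDimensional ℚ_[p] E'']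
    (r : FramedRep Γ E' n) :
    𝔅.IsAdmissible (FramedRep.restrictScalars ℚ_[p]
      (r.baseChange (IntermediateField.inclusion h).toRingHom
        (continuous_intermediateField_inclusion h))) ↔
      𝔅.IsAdmissible (FramedRep.restrictScalars ℚ_[p] r) := by
  -- adapted from `isAdmissible_restrictScalars_of_le` (PotentialDiagonalizabilityCriteriaProofs)
  classical
  letI : Algebra E' E'' := (IntermediateField.inclusion h).toRingHom.toAlgebra
  haveI : IsScalarTower ℚ_[p] E' E'' :=
    IsScalarTower.of_algebraMap_eq fun x => ((IntermediateField.inclusion h).commutes x).symm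
  haveI : FiniteDimensional E' E'' := Module.Finite.of_restrictScalars_finite ℚ_[p] E' E''
  haveI : FiniteDimensional ℚ_[p] E' := Module.Finite.of_injective
    (IntermediateField.inclusion h).toLinearMap (IntermediateField.inclusion h).toRingHom.injective
  set d := Module.finrank E' E'' with hd_def
  let b : Module.Basis (Fin d) E' E'' := Module.finBasis E' E''
  obtain ⟨k₀⟩ := b.index_nonempty
  -- the `ℚ_p`-linear isomorphism `(E'ⁿ)^d ≃ E''ⁿ`, `w ↦ (i ↦ Σ_k w k i • b k)`
  let e₀ : (Fin d → E') ≃ₗ[ℚ_[p]] E'' := b.equivFun.symm.restrictScalars ℚ_[p]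
  let sw : (Fin d → Fin n → E') ≃ₗ[ℚ_[p]] (Fin n → Fin d → E') :=
    { toFun := fun w i k => w k i
      invFun := fun v k i => v i k
      map_add' := fun _ _ => rfl
      map_smul' := fun _ _ => rfl
      left_inv := fun _ => rfl
      right_inv := fun _ => rfl }
  let Φ : (Fin d → Fin n → E') ≃ₗ[ℚ_[p]] (Fin n → E'') :=
    sw.trans (LinearEquiv.piCongrRight fun _ => e₀)
  have hΦ : ∀ (w : Fin d → Fin n → E') (i : Fin n), Φ w i = ∑ k, w k i • b k := fun w i => by
    change b.equivFun.symm (fun k => w k i) = _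
    rw [Module.Basis.equivFun_symm_apply]
  -- the representation `(r|_{ℚ_p})^d` on `(E'ⁿ)^d`
  obtain ⟨ρπ, hρπ⟩ := ContinuousRep.exists_pi (fun _ : Fin d => FramedRep.restrictScalars ℚ_[p] r)
  have hequiv : ∀ (σ : Γ) (w : Fin d → Fin n → E'),
      Φ (ρπ σ w) = (FramedRep.restrictScalars ℚ_[p] (r.baseChange
        (IntermediateField.inclusion h).toRingHom (continuous_intermediateField_inclusion h))) σ
          (Φ w) := by
    intro σ w
    funext i
    rw [FramedRep.restrictScalars_apply_apply, FramedRep.coe_baseChange_apply, hΦ]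
    simp only [hρπ, FramedRep.restrictScalars_apply_apply, Matrix.mulVec, dotProduct,
      Matrix.map_apply, hΦ, Finset.mul_sum, Finset.sum_smul]
    rw [Finset.sum_comm]
    refine Finset.sum_congr rfl fun j _ => Finset.sum_congr rfl fun k _ => ?_
    rw [Algebra.smul_def, Algebra.smul_def, map_mul, mul_assoc]
    rfl
  rw [← 𝔅.isAdmissible_iff_of_equiv ρπ _ Φ hequiv,
    𝔅.isAdmissible_pi_iff ρπ (fun _ : Fin d => FramedRep.restrictScalars ℚ_[p] r) hρπ]
  exact ⟨fun h' => h' k₀, fun h' _ => h'⟩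

variable {E' : Type v''} [Field E'] [Algebra ℚ_[p] E'] [TopologicalSpace E'] [IsTopologicalRing E']

/-- **Admissibility is invariant under a change of frame**: for `Q ∈ GL_n(E')`, the `ℚ_p`-restriction
of `Q r Q⁻¹` is `B`-admissible iff that of `r` is (`v ↦ Q v` is an isomorphism of `ℚ_p[Γ]`-modules).
Ref: Fontaine, Astérisque 223 (1994), Exposé III §1.5 (admissibility is a property of the isomorphism
class). [cite: FontaineAsterisque223III, Prop. 1.5.2] -/
theorem isAdmissible_restrictScalars_conj_iff (Q : GL (Fin n) E') (r : FramedRep Γ E' n) :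
    𝔅.IsAdmissible (FramedRep.restrictScalars ℚ_[p] (FramedRep.conj Q r)) ↔
      𝔅.IsAdmissible (FramedRep.restrictScalars ℚ_[p] r) := by
  let eQ : (Fin n → E') ≃ₗ[ℚ_[p]] (Fin n → E') :=
    { toFun := fun v => (Q : Matrix (Fin n) (Fin n) E') *ᵥ v
      invFun := fun v => ((Q⁻¹ : GL (Fin n) E') : Matrix (Fin n) (Fin n) E') *ᵥ v
      map_add' := fun v w => Matrix.mulVec_add _ v w
      map_smul' := fun c v => by
        simp only [RingHom.id_apply]
        rw [← algebraMap_smul E' c v, Matrix.mulVec_smul, algebraMap_smul]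
      left_inv := fun v => by
        change ((Q⁻¹ : GL (Fin n) E') : Matrix (Fin n) (Fin n) E') *ᵥ
          ((Q : Matrix (Fin n) (Fin n) E') *ᵥ v) = v
        rw [Matrix.mulVec_mulVec, ← Units.val_mul, inv_mul_cancel, Units.val_one, Matrix.one_mulVec]
      right_inv := fun v => by
        change (Q : Matrix (Fin n) (Fin n) E') *ᵥ
          (((Q⁻¹ : GL (Fin n) E') : Matrix (Fin n) (Fin n) E') *ᵥ v) = v
        rw [Matrix.mulVec_mulVec, ← Units.val_mul, mul_inv_cancel, Units.val_one,
          Matrix.one_mulVec] }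
  have heQ : ∀ (σ : Γ) (v : Fin n → E'), eQ (FramedRep.restrictScalars ℚ_[p] r σ v) =
      FramedRep.restrictScalars ℚ_[p] (FramedRep.conj Q r) σ (eQ v) := by
    intro σ v
    change (Q : Matrix (Fin n) (Fin n) E') *ᵥ
        (((r σ : GL (Fin n) E') : Matrix (Fin n) (Fin n) E') *ᵥ v) =
      ((FramedRep.conj Q r σ : GL (Fin n) E') : Matrix (Fin n) (Fin n) E') *ᵥ
        ((Q : Matrix (Fin n) (Fin n) E') *ᵥ v)
    rw [FramedRep.conj_apply, Matrix.mulVec_mulVec, Matrix.mulVec_mulVec, ← Units.val_mul,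
      ← Units.val_mul, inv_mul_cancel_right]
  exact (𝔅.isAdmissible_iff_of_equiv _ _ eQ heQ).symm

/-- **Sub-object and quotient of a block-triangular admissible representation are admissible**
(framed form of Fontaine's Prop. 1.5.2).  If `T : Γ →ₜ* GL_n(E')` (`E'/ℚ_p` finite) is block upper
triangular along `e : Fin m ⊕ Fin q ≃ Fin n` with diagonal blocks `A : Γ →ₜ* GL_m(E')`,
`D : Γ →ₜ* GL_q(E')`, then `w ↦ e·(w, 0)` and `v ↦ (v ∘ e)|_{Fin q}` form an exact sequence
`0 → E'^m → E'^n → E'^q → 0` of `ℚ_p[Γ]`-modules `A → T → D`, so if the `ℚ_p`-restriction of `T` is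
`B`-admissible then so are those of `A` and `D` (`isAdmissible_of_shortExact`: left exactness of `D_B`
and Fontaine's inequality).  Ref: Fontaine, Astérisque 223 (1994), Exposé III, Prop. 1.5.2.
[cite: FontaineAsterisque223III, Prop. 1.5.2] -/
theorem isAdmissible_restrictScalars_blocks [FiniteDimensional ℚ_[p] E'] {m q : ℕ}
    (e : Fin m ⊕ Fin q ≃ Fin n) (T : FramedRep Γ E' n) (A : FramedRep Γ E' m) (D : FramedRep Γ E' q)
    (hT : ∀ g, ∃ B : Matrix (Fin m) (Fin q) E',
      ((T g : GL (Fin n) E') : Matrix (Fin n) (Fin n) E') =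
        Matrix.reindex e e (Matrix.fromBlocks ((A g : GL (Fin m) E') : Matrix (Fin m) (Fin m) E') B 0
          ((D g : GL (Fin q) E') : Matrix (Fin q) (Fin q) E')))
    (hadm : 𝔅.IsAdmissible (FramedRep.restrictScalars ℚ_[p] T)) :
    𝔅.IsAdmissible (FramedRep.restrictScalars ℚ_[p] A) ∧
      𝔅.IsAdmissible (FramedRep.restrictScalars ℚ_[p] D) := by
  -- the inclusion of the first block and the projection onto the second
  obtain ⟨f, hf⟩ : ∃ f : (Fin m → E') →ₗ[ℚ_[p]] (Fin n → E'),
      ∀ w j, f w j = Sum.elim w 0 (e.symm j) :=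
    ⟨{ toFun := fun w j => Sum.elim w 0 (e.symm j)
       map_add' := fun w w' => funext fun j => by
         show Sum.elim (w + w') 0 (e.symm j) = Sum.elim w 0 (e.symm j) + Sum.elim w' 0 (e.symm j)
         rcases e.symm j with i | k <;> simp
       map_smul' := fun c w => funext fun j => by
         show Sum.elim (c • w) 0 (e.symm j) = c • Sum.elim w 0 (e.symm j)
         rcases e.symm j with i | k <;> simp }, fun _ _ => rfl⟩
  obtain ⟨g, hg⟩ : ∃ g : (Fin n → E') →ₗ[ℚ_[p]] (Fin q → E'),
      ∀ v k, g v k = v (e (Sum.inr k)) :=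
    ⟨{ toFun := fun v k => v (e (Sum.inr k))
       map_add' := fun _ _ => rfl
       map_smul' := fun _ _ => rfl }, fun _ _ => rfl⟩
  have hfw : ∀ w : Fin m → E', (f w : Fin n → E') ∘ e = Sum.elim w 0 := fun w =>
    funext fun x => by rw [Function.comp_apply, hf, Equiv.symm_apply_apply]
  have hf_eq : ∀ (σ : Γ) (w : Fin m → E'),
      f (FramedRep.restrictScalars ℚ_[p] A σ w) = FramedRep.restrictScalars ℚ_[p] T σ (f w) := by
    intro σ w
    obtain ⟨B, hB⟩ := hT σ
    rw [FramedRep.restrictScalars_apply_apply, FramedRep.restrictScalars_apply_apply, hB,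
      Matrix.reindex_apply, Matrix.submatrix_mulVec_equiv, Equiv.symm_symm, hfw,
      Matrix.fromBlocks_mulVec]
    funext j
    rw [hf]
    simp
  have hg_eq : ∀ (σ : Γ) (v : Fin n → E'),
      g (FramedRep.restrictScalars ℚ_[p] T σ v) = FramedRep.restrictScalars ℚ_[p] D σ (g v) := by
    intro σ v
    obtain ⟨B, hB⟩ := hT σ
    have hgv : (g v : Fin q → E') = (v ∘ e) ∘ Sum.inr := funext fun k => hg v k
    funext k
    rw [hg, FramedRep.restrictScalars_apply_apply, FramedRep.restrictScalars_apply_apply, hB,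
      Matrix.reindex_apply, Matrix.submatrix_mulVec_equiv, Equiv.symm_symm,
      Matrix.fromBlocks_mulVec, hgv]
    simp
  have hinj : Function.Injective f := fun w w' hww' => funext fun i => by
    have h1 := congrFun hww' (e (Sum.inl i))
    rwa [hf, hf, Equiv.symm_apply_apply, Sum.elim_inl, Sum.elim_inl] at h1
  have hsurj : Function.Surjective g := fun u =>
    ⟨fun j => Sum.elim 0 u (e.symm j), funext fun k => by
      rw [hg, Equiv.symm_apply_apply, Sum.elim_inr]⟩
  have hex : Function.Exact f g := by
    intro v
    constructor
    · intro hv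
      refine ⟨fun i => v (e (Sum.inl i)), funext fun j => ?_⟩
      rw [hf, ← e.apply_symm_apply j]
      rcases e.symm j with i | k
      · rw [Equiv.symm_apply_apply, Sum.elim_inl]
      · have hk := congrFun hv k
        rw [hg, Pi.zero_apply] at hk
        rw [Equiv.symm_apply_apply, Sum.elim_inr, hk, Pi.zero_apply]
    · rintro ⟨w, rfl⟩
      funext k
      simp only [hg, hf, Equiv.symm_apply_apply, Sum.elim_inr, Pi.zero_apply]
  exact 𝔅.isAdmissible_of_shortExact (FramedRep.restrictScalars ℚ_[p] A)
    (FramedRep.restrictScalars ℚ_[p] T) (FramedRep.restrictScalars ℚ_[p] D) f g hf_eq hg_eq hinj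
    hsurj hex hadm

end Coefficients

end PeriodRingData

/-! ### Descent of the frame to a finite extension of `ℚ_ℓ` -/

section Descent

universe u

variable {ℓ : ℕ} [Fact ℓ.Prime] {n : ℕ}

/-- The entries of the extension of scalars to `ℚ̄_ℓ` of a framed representation over `E' ⊆ ℚ̄_ℓ`
lie in `E'`. [folklore] -/
theorem FramedRep.baseChange_apply_mem {G : Type u} [Group G] [TopologicalSpace G]
    {E' : IntermediateField ℚ_[ℓ] (PadicAlgCl ℓ)} (ρE : FramedRep G E' n) (g : G) (i j : Fin n) :
    ((ρE.baseChange (algebraMap E' (PadicAlgCl ℓ)) continuous_subtype_val g :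
      GL (Fin n) (PadicAlgCl ℓ)) : Matrix (Fin n) (Fin n) (PadicAlgCl ℓ)) i j ∈ E' := by
  rw [FramedRep.coe_baseChange_apply, Matrix.map_apply]
  exact SetLike.coe_mem _

/-- **Descent of the frame.**  If `T : Γ_K → GL_n(ℚ̄_ℓ)` has the model `rE` over `E` (accepted
`HasQlModel`: `T = P (rE ⊗ ℚ̄_ℓ) P⁻¹`, `P ∈ GL_n(ℚ̄_ℓ)`), then over the finite extension
`E' = E · ℚ_ℓ(entries of P, P⁻¹)` one has `P = Q ⊗ ℚ̄_ℓ` with `Q ∈ GL_n(E')`, and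
`T = (Q (rE ⊗_E E') Q⁻¹) ⊗_{E'} ℚ̄_ℓ` is the extension of scalars of a framed representation over `E'`.
Ref: Buzzard–Gee 2014, §2.2 (coefficient fields of `ℓ`-adic Galois representations). [folklore] -/
theorem exists_conj_baseChange_eq_of_hasQlModel {K : Type u} [Field K]
    {T : FramedGaloisRep K (PadicAlgCl ℓ) n} {E : IntermediateField ℚ_[ℓ] (PadicAlgCl ℓ)}
    [FiniteDimensional ℚ_[ℓ] E] {rE : FramedGaloisRep K E n}
    (h : Literature.NumberTheory.Automorphic.HasQlModel T E rE) :
    ∃ (E' : IntermediateField ℚ_[ℓ] (PadicAlgCl ℓ)) (hE : E ≤ E') (_ : FiniteDimensional ℚ_[ℓ] E')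
      (Q : GL (Fin n) E'),
      (FramedRep.conj Q (rE.baseChange (IntermediateField.inclusion hE).toRingHom
        (continuous_intermediateField_inclusion hE))).baseChange (algebraMap E' (PadicAlgCl ℓ))
          continuous_subtype_val = T := by
  obtain ⟨P, hP⟩ := h
  obtain ⟨E_P, hE_P, hPmem⟩ := exists_finiteDimensional_mem_entries P
  haveI := hE_P
  refine ⟨E ⊔ E_P, le_sup_left, inferInstance, ?_⟩
  set E' : IntermediateField ℚ_[ℓ] (PadicAlgCl ℓ) := E ⊔ E_P with hE'
  have h2 : E_P ≤ E' := le_sup_right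
  have hPE : ∀ i j, (P : Matrix (Fin n) (Fin n) (PadicAlgCl ℓ)) i j ∈ E' := fun i j =>
    h2 (hPmem i j).1
  have hPE' : ∀ i j, ((P⁻¹ : GL (Fin n) (PadicAlgCl ℓ)) : Matrix (Fin n) (Fin n) (PadicAlgCl ℓ))
      i j ∈ E' := fun i j => h2 (hPmem i j).2
  obtain ⟨hm1, hm2⟩ := Literature.NumberTheory.Automorphic.of_entries_mul_of_entries_inv E' P hPE hPE'
  let Q : GL (Fin n) E' :=
    ⟨Matrix.of fun i j => ⟨(P : Matrix (Fin n) (Fin n) (PadicAlgCl ℓ)) i j, hPE i j⟩,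
      Matrix.of fun i j => ⟨((P⁻¹ : GL (Fin n) (PadicAlgCl ℓ)) :
        Matrix (Fin n) (Fin n) (PadicAlgCl ℓ)) i j, hPE' i j⟩, hm1, hm2⟩
  have hQ : Matrix.GeneralLinearGroup.map (algebraMap E' (PadicAlgCl ℓ)) Q = P := by
    apply Units.ext
    ext i j
    rfl
  refine ⟨Q, ?_⟩
  rw [FramedRep.baseChange_conj, hQ, ← hP]
  -- `(rE ⊗_E E') ⊗_{E'} ℚ̄_ℓ = rE ⊗_E ℚ̄_ℓ`, definitionally
  congr 1

/-- **The blocks descend with the frame.**  If `T : G →ₜ* GL_n(ℚ̄_ℓ)` is block upper triangular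
along `e : Fin m ⊕ Fin q ≃ Fin n` with diagonal blocks the framed representations `A`, `D`, and `T` is
the extension of scalars of `TE : G →ₜ* GL_n(E')`, `E' ⊆ ℚ̄_ℓ`, then all entries of `A`, `D` (and of the
off-diagonal block) lie in `E'`, so `A`, `D` are extensions of scalars of framed `AE`, `DE` over `E'`
(the corestrictions, `FramedRep.exists_baseChange_eq`) and `TE` is block upper triangular over `E'`
with diagonal blocks `AE`, `DE`. [folklore] -/
theorem FramedRep.exists_blocks_of_baseChange_eq {G : Type u} [Group G] [TopologicalSpace G]
    {m q : ℕ} (e : Fin m ⊕ Fin q ≃ Fin n) {E' : IntermediateField ℚ_[ℓ] (PadicAlgCl ℓ)}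
    (TE : FramedRep G E' n) (T : FramedRep G (PadicAlgCl ℓ) n) (A : FramedRep G (PadicAlgCl ℓ) m)
    (D : FramedRep G (PadicAlgCl ℓ) q)
    (hT : ∀ g, ∃ B : Matrix (Fin m) (Fin q) (PadicAlgCl ℓ),
      ((T g : GL (Fin n) (PadicAlgCl ℓ)) : Matrix (Fin n) (Fin n) (PadicAlgCl ℓ)) =
        Matrix.reindex e e (Matrix.fromBlocks
          ((A g : GL (Fin m) (PadicAlgCl ℓ)) : Matrix (Fin m) (Fin m) (PadicAlgCl ℓ)) B 0
          ((D g : GL (Fin q) (PadicAlgCl ℓ)) : Matrix (Fin q) (Fin q) (PadicAlgCl ℓ))))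
    (hTE : TE.baseChange (algebraMap E' (PadicAlgCl ℓ)) continuous_subtype_val = T) :
    ∃ (AE : FramedRep G E' m) (DE : FramedRep G E' q),
      AE.baseChange (algebraMap E' (PadicAlgCl ℓ)) continuous_subtype_val = A ∧
      DE.baseChange (algebraMap E' (PadicAlgCl ℓ)) continuous_subtype_val = D ∧
      ∀ g, ∃ B : Matrix (Fin m) (Fin q) E',
        ((TE g : GL (Fin n) E') : Matrix (Fin n) (Fin n) E') =
          Matrix.reindex e e (Matrix.fromBlocks ((AE g : GL (Fin m) E') : Matrix (Fin m) (Fin m) E')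
            B 0 ((DE g : GL (Fin q) E') : Matrix (Fin q) (Fin q) E')) := by
  -- entries of `T`, `A`, `D` lie in `E'`
  have hTmem : ∀ g i j, ((T g : GL (Fin n) (PadicAlgCl ℓ)) :
      Matrix (Fin n) (Fin n) (PadicAlgCl ℓ)) i j ∈ E' := fun g i j => by
    rw [← hTE]
    exact TE.baseChange_apply_mem g i j
  have hAT : ∀ g i j, ((A g : GL (Fin m) (PadicAlgCl ℓ)) : Matrix (Fin m) (Fin m) (PadicAlgCl ℓ)) i j =
      ((T g : GL (Fin n) (PadicAlgCl ℓ)) : Matrix (Fin n) (Fin n) (PadicAlgCl ℓ))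
        (e (Sum.inl i)) (e (Sum.inl j)) := fun g i j => by
    obtain ⟨B, hB⟩ := hT g
    rw [hB]
    simp
  have hDT : ∀ g i j, ((D g : GL (Fin q) (PadicAlgCl ℓ)) : Matrix (Fin q) (Fin q) (PadicAlgCl ℓ)) i j =
      ((T g : GL (Fin n) (PadicAlgCl ℓ)) : Matrix (Fin n) (Fin n) (PadicAlgCl ℓ))
        (e (Sum.inr i)) (e (Sum.inr j)) := fun g i j => by
    obtain ⟨B, hB⟩ := hT g
    rw [hB]
    simp
  have hAmem : ∀ g i j, ((A g : GL (Fin m) (PadicAlgCl ℓ)) :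
      Matrix (Fin m) (Fin m) (PadicAlgCl ℓ)) i j ∈ E' ∧ (((A g)⁻¹ : GL (Fin m) (PadicAlgCl ℓ)) :
        Matrix (Fin m) (Fin m) (PadicAlgCl ℓ)) i j ∈ E' := fun g i j =>
    ⟨by rw [hAT]; exact hTmem g _ _, by rw [← map_inv, hAT]; exact hTmem g⁻¹ _ _⟩
  have hDmem : ∀ g i j, ((D g : GL (Fin q) (PadicAlgCl ℓ)) :
      Matrix (Fin q) (Fin q) (PadicAlgCl ℓ)) i j ∈ E' ∧ (((D g)⁻¹ : GL (Fin q) (PadicAlgCl ℓ)) :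
        Matrix (Fin q) (Fin q) (PadicAlgCl ℓ)) i j ∈ E' := fun g i j =>
    ⟨by rw [hDT]; exact hTmem g _ _, by rw [← map_inv, hDT]; exact hTmem g⁻¹ _ _⟩
  obtain ⟨AE, hAE⟩ := FramedRep.exists_baseChange_eq A E' hAmem
  obtain ⟨DE, hDE⟩ := FramedRep.exists_baseChange_eq D E' hDmem
  refine ⟨AE, DE, hAE, hDE, fun g => ?_⟩
  obtain ⟨B, hB⟩ := hT g
  refine ⟨Matrix.of fun i k => ((TE g : GL (Fin n) E') : Matrix (Fin n) (Fin n) E')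
    (e (Sum.inl i)) (e (Sum.inr k)), ?_⟩
  apply Matrix.map_injective (algebraMap E' (PadicAlgCl ℓ)).injective
  have hTg : ((TE g : GL (Fin n) E') : Matrix (Fin n) (Fin n) E').map (algebraMap E' (PadicAlgCl ℓ)) =
      ((T g : GL (Fin n) (PadicAlgCl ℓ)) : Matrix (Fin n) (Fin n) (PadicAlgCl ℓ)) := by
    rw [← hTE, FramedRep.coe_baseChange_apply]
  have hAg : ((AE g : GL (Fin m) E') : Matrix (Fin m) (Fin m) E').map (algebraMap E' (PadicAlgCl ℓ)) =
      ((A g : GL (Fin m) (PadicAlgCl ℓ)) : Matrix (Fin m) (Fin m) (PadicAlgCl ℓ)) := by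
    rw [← hAE, FramedRep.coe_baseChange_apply]
  have hDg : ((DE g : GL (Fin q) E') : Matrix (Fin q) (Fin q) E').map (algebraMap E' (PadicAlgCl ℓ)) =
      ((D g : GL (Fin q) (PadicAlgCl ℓ)) : Matrix (Fin q) (Fin q) (PadicAlgCl ℓ)) := by
    rw [← hDE, FramedRep.coe_baseChange_apply]
  have hBg : (Matrix.of fun i k => ((TE g : GL (Fin n) E') : Matrix (Fin n) (Fin n) E')
      (e (Sum.inl i)) (e (Sum.inr k))).map (algebraMap E' (PadicAlgCl ℓ)) = B := by
    ext i k
    rw [Matrix.map_apply, Matrix.of_apply, ← Matrix.map_apply (f := algebraMap E' (PadicAlgCl ℓ)),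
      hTg, hB]
    simp
  simp only [Matrix.reindex_apply]
  rw [hTg, ← Matrix.submatrix_map, Matrix.fromBlocks_map, hAg, hDg, hBg,
    Matrix.map_zero _ (map_zero _)]
  simpa only [Matrix.reindex_apply] using hB

end Descent

/-! ### De Rham heredity -/

section DeRham

variable {F : Type} [Field F] {ℓ : ℕ} [Fact ℓ.Prime]

-- Mathlib's own global value (nested instance problems on `𝔅.B ⊗[P] M`, see `PAdicHodgeProofs`).
set_option maxSynthPendingDepth 3 in
/-- **De Rham heredity for block-triangular framed representations** (Fontaine, Exposé III,
Prop. 1.5.2: for a regular `(ℚ_ℓ, Γ)`-ring `B`, sub-objects and quotients of `B`-admissible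
representations are `B`-admissible).  For a `ℚ_ℓ`-algebra structure `alg` on `F` and a period-ring
datum `𝔅` for `Γ_F` (its ring is regular by the `PeriodRingData` axioms; Fontaine's inequality is the
tree's `finrank_D_le_holds`): if `T : Γ_F →ₜ* GL_n(ℚ̄_ℓ)` is block upper triangular along
`e : Fin m ⊕ Fin q ≃ Fin n` with diagonal blocks `A` (the sub-object) and `D` (the quotient), and `T`
is de Rham for `(alg, 𝔅)` (accepted `FramedRep.IsDeRhamWith`), then so are `A` and `D` — with the
model field `E' = E(P, P⁻¹)` of the descent of the frame (`exists_conj_baseChange_eq_of_hasQlModel`),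
the models being the corestrictions of `A`, `D` (`FramedRep.exists_blocks_of_baseChange_eq`) and the
admissibility being `PeriodRingData.isAdmissible_restrictScalars_blocks` after the changes of
coefficients and frame (`…_baseChange_iff`, `…_conj_iff`).
Ref: Fontaine, Astérisque 223 (1994), Exposé III, Prop. 1.5.2. [cite: FontaineAsterisque223III, Prop. 1.5.2] -/
theorem FramedRep.IsDeRhamWith.blocks (alg : Algebra ℚ_[ℓ] F)
    (𝔅 : PeriodRingData.{0, 0, 0, 0} (absoluteGaloisGroup F) ℚ_[ℓ] F) {m q n : ℕ}
    (e : Fin m ⊕ Fin q ≃ Fin n) {T : FramedRep (absoluteGaloisGroup F) (PadicAlgCl ℓ) n}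
    {A : FramedRep (absoluteGaloisGroup F) (PadicAlgCl ℓ) m}
    {D : FramedRep (absoluteGaloisGroup F) (PadicAlgCl ℓ) q}
    (hT : ∀ g, ∃ B : Matrix (Fin m) (Fin q) (PadicAlgCl ℓ),
      ((T g : GL (Fin n) (PadicAlgCl ℓ)) : Matrix (Fin n) (Fin n) (PadicAlgCl ℓ)) =
        Matrix.reindex e e (Matrix.fromBlocks
          ((A g : GL (Fin m) (PadicAlgCl ℓ)) : Matrix (Fin m) (Fin m) (PadicAlgCl ℓ)) B 0
          ((D g : GL (Fin q) (PadicAlgCl ℓ)) : Matrix (Fin q) (Fin q) (PadicAlgCl ℓ))))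
    (h : T.IsDeRhamWith alg 𝔅) : A.IsDeRhamWith alg 𝔅 ∧ D.IsDeRhamWith alg 𝔅 := by
  letI := alg
  obtain ⟨E, hE, rE, hmodel, hadm⟩ := h
  haveI := hE
  obtain ⟨E', hEE', hE', Q, hTQ⟩ := exists_conj_baseChange_eq_of_hasQlModel hmodel
  haveI := hE'
  have hadmTE : 𝔅.IsAdmissible (FramedRep.restrictScalars ℚ_[ℓ] (FramedRep.conj Q
      (rE.baseChange (IntermediateField.inclusion hEE').toRingHom
        (continuous_intermediateField_inclusion hEE')))) := by
    rw [𝔅.isAdmissible_restrictScalars_conj_iff, 𝔅.isAdmissible_restrictScalars_baseChange_iff]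
    exact hadm
  obtain ⟨AE, DE, hAE, hDE, hblocks⟩ := FramedRep.exists_blocks_of_baseChange_eq e _ T A D hT hTQ
  obtain ⟨hA, hD⟩ := 𝔅.isAdmissible_restrictScalars_blocks e _ AE DE hblocks hadmTE
  have hconj : ∀ {k : ℕ} (ρ : FramedRep (absoluteGaloisGroup F) (PadicAlgCl ℓ) k),
      FramedRep.conj 1 ρ = ρ := fun ρ =>
    ContinuousMonoidHom.ext fun σ => by rw [FramedRep.conj_apply, one_mul, inv_one, mul_one]
  exact ⟨⟨E', hE', AE, ⟨1, by rw [hAE]; exact hconj A⟩, hA⟩,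
    ⟨E', hE', DE, ⟨1, by rw [hDE]; exact hconj D⟩, hD⟩⟩

/-- **De Rham heredity, for a `p`-adic Hodge datum** (accepted `PstWeilDeligneData`,
`IsDeRhamFramed`): for every non-archimedean local field `F`, prime `ℓ` and datum `𝔇`, the diagonal
blocks `A`, `D` of a block upper triangular framed `T : Γ_F →ₜ* GL_n(ℚ̄_ℓ)` which is de Rham for `𝔇`
are de Rham for `𝔇` (`FramedRep.IsDeRhamWith.blocks` for `(𝔇.algebra, 𝔇.𝔅)`).
Ref: Fontaine, Astérisque 223 (1994), Exposé III, Prop. 1.5.2. [cite: FontaineAsterisque223III, Prop. 1.5.2] -/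
theorem PstWeilDeligneData.isDeRhamFramed_blocks [ValuativeRel F] [TopologicalSpace F]
    [IsNonarchimedeanLocalField F] (𝔇 : PstWeilDeligneData F ℓ) {m q n : ℕ}
    (e : Fin m ⊕ Fin q ≃ Fin n) {T : FramedRep (absoluteGaloisGroup F) (PadicAlgCl ℓ) n}
    {A : FramedRep (absoluteGaloisGroup F) (PadicAlgCl ℓ) m}
    {D : FramedRep (absoluteGaloisGroup F) (PadicAlgCl ℓ) q}
    (hT : ∀ g, ∃ B : Matrix (Fin m) (Fin q) (PadicAlgCl ℓ),
      ((T g : GL (Fin n) (PadicAlgCl ℓ)) : Matrix (Fin n) (Fin n) (PadicAlgCl ℓ)) =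
        Matrix.reindex e e (Matrix.fromBlocks
          ((A g : GL (Fin m) (PadicAlgCl ℓ)) : Matrix (Fin m) (Fin m) (PadicAlgCl ℓ)) B 0
          ((D g : GL (Fin q) (PadicAlgCl ℓ)) : Matrix (Fin q) (Fin q) (PadicAlgCl ℓ))))
    (h : 𝔇.IsDeRhamFramed T) : 𝔇.IsDeRhamFramed A ∧ 𝔇.IsDeRhamFramed D :=
  FramedRep.IsDeRhamWith.blocks 𝔇.algebra 𝔇.𝔅 e hT h

end DeRham

end Literature.NumberTheory.GaloisRepresentations
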